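import Literature.Analysis.FluidPDE.PassiveVectorTensorDistortedConstFrameTranslate
import Literature.Analysis.FluidPDE.PassiveVectorTensorDistortedConstFrameSuperposition
import Literature.Analysis.FluidPDE.PassiveVectorTensorSymmetry
import HarnessLib

/-!
# Translation symmetries of the CONSTANT-FRAME distorted weak passive-vector class: Bloch-sector preservation

Analysis/FluidPDE proof-support file (everything proved; no new definitions, no named facts).

Twin of `PassiveVectorTensorSymmetry` for the constant-frame distorted class
`Torus.IsWeakTensorPassiveVectorDistortedOn A T 𝔸 b (fun _ _ => G₀) w₀ w` (Armstrong–Vicol's Lagrangian-coordinate ansatz with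
the distortion frozen, arXiv:2305.05048 §4.1): for a carrier `b` invariant under a finite family of translations of the torus,
a constant tensor `𝔸` in a Legendre–Hadamard window and a NON-DEGENERATE constant frame (`c|k|² ≤ |G₀ᵀk|²`, `0 < c`), the
translation average `Σᵢ cᵢ • w(·, · + gᵢ)` of a solution is a solution (`sum_smul_translate_constFrame'`: covariance
`translate_constFrame` + superposition `const_smul_constFrame`/`finset_sum_constFrame`), hence by UNIQUENESS in the class
(`ae_eq_of_memLp_top_constFrame`) **the Fourier support of every solution stays inside any level set `{k : ĉ(k) = m}`, `m ≠ 0`,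
of the multiplier `ĉ(k) = Σᵢ cᵢ e_k(gᵢ)` that contains the support of the datum** (`ae_mFourierCoeff_eq_zero_of_multiplier_constFrame'`),
and in particular — with the `n`-torsion grid and cosine weights (`TorusGridCharacters.sum_cos_mul_mFourier_grid`) — **along a
`1/n`-periodic carrier a datum supported in the symmetric Bloch sector `{k ≡ ±ℓ (mod n)}` generates only solutions supported in
that sector, for a.e. time** (`ae_mFourierCoeff_eq_zero_off_sector_constFrame`).  Kha–Kuchment's «a `G`-periodic operator commutes
with the `G`-action, so the `γ_k`-automorphic sectors are invariant» (§1.1–§1.2) for the frozen-frame problem: a constant frame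
is translation invariant, so nothing of the flat argument changes.
Step B3 of the port plan `HOME/ad-sawtooth-k1loc-p1/g16/W7thg-portplan-k1locp1g16.md` (cell `ad-ideate`, K1L_D
stmt-AnomalousDissipation-27980): the shared prerequisite of the class-pair confinement of the frozen cell problem for BOTH graded
inputs (V_θg) (`stub_D1_V0thg`, w1 lineage L2 `…CellChainClassPairFrame`) and (W_θg) (`stub_W7thg`, `…ClassReductionFrame`).

## Mathlib / tree search

Tree: `PassiveVectorTensorSymmetry` (flat `of_ae_eq_datum`, `sum_smul_translate'`, `ae_mFourierCoeff_eq_zero_of_multiplier'`,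
`ae_mFourierCoeff_eq_zero_off_sector`, `mFourierCoeff_complexify_sum_smul_translate'`), `TorusGridCharacters`
(`sum_cos_mul_mFourier_grid`), `PassiveVectorTensorDistortedConstFrameTranslate` (`translate_constFrame`),
`PassiveVectorTensorDistortedConstFrameSuperposition` (`const_smul_constFrame`, `finset_sum_constFrame`),
`PassiveVectorTensorDistortedConstFrameUniqueness` (`ae_eq_of_memLp_top_constFrame`).  `rg sector
Literature/Analysis/FluidPDE/PassiveVectorTensorDistorted*.lean`: nothing (2026-08-29).

## References

* M. Kha, P. Kuchment, *Liouville–Riemann–Roch Theorems on Abelian Coverings*, LNM 2245 (2021), §1.1–§1.2. [`KhaKuchment2021`]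
* S. Armstrong, V. Vicol, *Anomalous diffusion by fractal homogenization*, arXiv:2305.05048, §4.1, PDF p. 34. [`ArmstrongVicol2025`]
* R. J. DiPerna, P.-L. Lions, Invent. Math. 98 (1989) 511–547, §II.1 (12)–(14). [`DiPernaLions1989`]
-/

noncomputable section

open MeasureTheory TopologicalSpace Set Function Filter Topology UnitAddTorus
open scoped ENNReal NNReal InnerProductSpace

namespace Literature.Analysis.FluidPDE

namespace Torus

variable {d : Type*} [Fintype d] [DecidableEq d]

namespace IsWeakTensorPassiveVectorDistortedOn

variable {A T : ℝ} {𝔸 : Visc4 d} {b w : ℝ → UnitAddTorus d → EuclideanSpace ℝ d}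
  {G : ℝ → UnitAddTorus d → Matrix d d ℝ} {G₀ : Matrix d d ℝ} {w₀ w₀' : UnitAddTorus d → EuclideanSpace ℝ d}

/-- The distorted weak class sees the datum only through the pairing `∫⟪w₀, Ψ(0)⟫`: a.e.-equal data give the same class
(any frame). [cite: DiPernaLions1989, §II.1 (12)–(14)] -/
theorem of_ae_eq_datum_dist (h : IsWeakTensorPassiveVectorDistortedOn A T 𝔸 b G w₀ w) (hw : w₀ =ᵐ[volume] w₀') :
    IsWeakTensorPassiveVectorDistortedOn A T 𝔸 b G w₀' w where
  aestronglyMeasurable := h.aestronglyMeasurable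
  aestronglyMeasurable_carrier := h.aestronglyMeasurable_carrier
  ae_lintegral_sq_le := h.ae_lintegral_sq_le
  lintegral_carrier_lt_top := h.lintegral_carrier_lt_top
  lintegral_mul_lt_top := h.lintegral_mul_lt_top
  ae_isWeaklyDivFree_carrier := h.ae_isWeaklyDivFree_carrier
  ae_isWeaklyDivFree_distort := h.ae_isWeaklyDivFree_distort
  weak_eq Ψ hΨ hΨdiv := by
    have e : ∫ x, ⟪w₀' x, Ψ 0 x⟫_ℝ = ∫ x, ⟪w₀ x, Ψ 0 x⟫_ℝ := by
      refine integral_congr_ae ?_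
      filter_upwards [hw] with x hx
      rw [hx]
    rw [e]
    exact h.weak_eq Ψ hΨ hΨdiv

/-- **Translation averages of constant-frame solutions are solutions**: for a finite family of translations `gᵢ` leaving
the carrier invariant and real weights `cᵢ`, `Σᵢ cᵢ • w(·, · + gᵢ)` is a constant-frame solution along the same carrier from
`Σᵢ cᵢ • w₀(· + gᵢ)`. [cite: KhaKuchment2021, §1.1 (G-periodic operators commute with the G-action)] [cite: ArmstrongVicol2025, §4.1 (PDF p. 34)] -/
theorem sum_smul_translate_constFrame' (h : IsWeakTensorPassiveVectorDistortedOn A T 𝔸 b (fun _ _ => G₀) w₀ w)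
    {ι : Type*} [Fintype ι] [Nonempty ι] (g : ι → UnitAddTorus d) (c : ι → ℝ) (hper : ∀ i t x, b t (x + g i) = b t x)
    (hw₀ : Integrable w₀ volume) :
    IsWeakTensorPassiveVectorDistortedOn A T 𝔸 b (fun _ _ => G₀) (fun x => ∑ i, c i • w₀ (x + g i)) (fun t x => ∑ i, c i • w t (x + g i)) := by
  have hint : ∀ i ∈ (Finset.univ : Finset ι), Integrable (fun x => c i • w₀ (x + g i)) volume :=
    fun i _ => by simpa only [Pi.smul_def] using (hw₀.comp_add_right (g i)).smul (c i)
  have hsol : ∀ i ∈ (Finset.univ : Finset ι), IsWeakTensorPassiveVectorDistortedOn A T 𝔸 b (fun _ _ => G₀) (fun x => c i • w₀ (x + g i))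
      (fun t x => c i • w t (x + g i)) := by
    intro i _
    have hb : (fun t x => b t (x + g i)) = b := by
      funext t x
      exact hper i t x
    have h1 := (h.translate_constFrame (g i)).const_smul_constFrame (c i)
    rw [hb] at h1
    exact h1
  exact finset_sum_constFrame Finset.univ Finset.univ_nonempty hint hsol

/-- **Fourier-support confinement for the constant-frame class (Bloch-sector preservation of EVERY solution).**  Constant
tensor in a Legendre–Hadamard window (`NearIso 𝔸 lo hi`, `0 < lo`), non-degenerate constant frame (`c₀|k|² ≤ |G₀ᵀk|²`, `0 < c₀`),
essentially bounded carrier invariant under the translations `gᵢ`, datum `w₀ ∈ L²`.  If the multiplier `ĉ(k) = Σᵢ cᵢ e_k(gᵢ)` of a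
real translation average takes one NONZERO real value `m` on the Fourier support of the datum, then for a.e. `t ∈ (0,T)` the Fourier
coefficients of `w(t)` vanish wherever `ĉ(k) ≠ m` (the rescaled average is a solution from an a.e. representative of the datum,
hence equals `w` a.e. by `ae_eq_of_memLp_top_constFrame`; compare coefficients).
[cite: KhaKuchment2021, §1.1–§1.2 (G-periodic operators, γ_k-automorphic functions, Floquet transform)] [cite: ArmstrongVicol2025, §4.1 (PDF p. 34)] -/
theorem ae_mFourierCoeff_eq_zero_of_multiplier_constFrame' {lo hi : ℝ} (h𝔸 : NearIso 𝔸 lo hi) (hlo : 0 < lo)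
    {c₀ : ℝ} (hc₀ : 0 < c₀) (hG : ∀ k : d → ℤ, c₀ * FunctionSpaces.Torus.freqNormSq k ≤ ∑ a, twistFreq G₀ k a ^ 2)
    (h : IsWeakTensorPassiveVectorDistortedOn A T 𝔸 b (fun _ _ => G₀) w₀ w)
    (hb : MemLp (FunctionSpaces.Torus.stLift b) ∞ (volume.restrict (Ioo 0 T ×ˢ univ)))
    {ι : Type*} [Fintype ι] [Nonempty ι] (g : ι → UnitAddTorus d) (c : ι → ℝ)
    (hper : ∀ i t x, b t (x + g i) = b t x) (hw₀ : MemLp w₀ 2 volume) {m : ℝ} (hm : m ≠ 0)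
    (hsupp : ∀ k, mFourierCoeff (FunctionSpaces.EuclideanSpace.complexify ∘ w₀) k ≠ 0 →
      (∑ i, (c i : ℂ) * mFourier k (g i)) = m) :
    ∀ᵐ t ∂(volume.restrict (Ioo 0 T)), ∀ k, (∑ i, (c i : ℂ) * mFourier k (g i)) ≠ m →
      mFourierCoeff (FunctionSpaces.EuclideanSpace.complexify ∘ w t) k = 0 := by
  have hw₀i : Integrable w₀ volume := hw₀.integrable one_le_two
  have hcx : ∀ {u : UnitAddTorus d → EuclideanSpace ℝ d}, Integrable u volume →
      Integrable (FunctionSpaces.EuclideanSpace.complexify ∘ u) volume :=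
    fun hu => FunctionSpaces.EuclideanSpace.complexify.toContinuousLinearMap.integrable_comp hu
  have hsm : ∀ (u : UnitAddTorus d → EuclideanSpace ℝ d),
      (FunctionSpaces.EuclideanSpace.complexify ∘ fun x => m⁻¹ • u x) =
        ((m⁻¹ : ℝ) : ℂ) • (FunctionSpaces.EuclideanSpace.complexify ∘ u) := by
    intro u
    funext x
    simp only [Function.comp_apply, LinearIsometry.map_smul, Pi.smul_apply, Complex.coe_smul]
  have hR := (h.sum_smul_translate_constFrame' g c hper hw₀i).const_smul_constFrame m⁻¹
  have hS₀i : Integrable (fun x => ∑ i, c i • w₀ (x + g i)) volume :=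
    integrable_finsetSum _ fun i _ => by simpa only [Pi.smul_def] using (hw₀i.comp_add_right (g i)).smul (c i)
  have hR₀i : Integrable (fun x => m⁻¹ • ∑ i, c i • w₀ (x + g i)) volume := by
    simpa only [Pi.smul_def] using hS₀i.smul m⁻¹
  have hcoef : ∀ k, mFourierCoeff (FunctionSpaces.EuclideanSpace.complexify ∘ fun x => m⁻¹ • ∑ i, c i • w₀ (x + g i)) k =
      mFourierCoeff (FunctionSpaces.EuclideanSpace.complexify ∘ w₀) k := by
    intro k
    rw [hsm, FunctionSpaces.Torus.mFourierCoeff_const_smul, mFourierCoeff_complexify_sum_smul_translate' g c hw₀i]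
    by_cases hk : mFourierCoeff (FunctionSpaces.EuclideanSpace.complexify ∘ w₀) k = 0
    · rw [hk, smul_zero, smul_zero]
    · rw [hsupp k hk, smul_smul, ← Complex.ofReal_mul, inv_mul_cancel₀ hm, Complex.ofReal_one, one_smul]
  have hae : (fun x => m⁻¹ • ∑ i, c i • w₀ (x + g i)) =ᵐ[volume] w₀ := by
    filter_upwards [FunctionSpaces.Torus.ae_eq_of_forall_mFourierCoeff_eq (hcx hR₀i) (hcx hw₀i) hcoef] with x hx
    exact FunctionSpaces.EuclideanSpace.complexify_injective hx
  have hsol : IsWeakTensorPassiveVectorDistortedOn A T 𝔸 b (fun _ _ => G₀) w₀ (fun t x => m⁻¹ • ∑ i, c i • w t (x + g i)) :=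
    hR.of_ae_eq_datum_dist hae
  filter_upwards [ae_eq_of_memLp_top_constFrame h𝔸 hlo hc₀ hG h hsol hb, h.ae_memLp_two] with t ht hm2
  intro k hk
  have hwi : Integrable (w t) volume := hm2.integrable one_le_two
  have e1 : mFourierCoeff (FunctionSpaces.EuclideanSpace.complexify ∘ w t) k =
      mFourierCoeff (FunctionSpaces.EuclideanSpace.complexify ∘ fun x => m⁻¹ • ∑ i, c i • w t (x + g i)) k := by
    refine FunctionSpaces.Torus.mFourierCoeff_congr_ae ?_ k
    filter_upwards [ht] with x hx
    simp only [Function.comp_apply, hx]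
  rw [hsm, FunctionSpaces.Torus.mFourierCoeff_const_smul, mFourierCoeff_complexify_sum_smul_translate' g c hwi,
    smul_smul] at e1
  have hne : ((m⁻¹ : ℝ) : ℂ) * (∑ i, (c i : ℂ) * mFourier k (g i)) ≠ 1 := by
    intro h1
    apply hk
    have hm' : (m : ℂ) ≠ 0 := by exact_mod_cast hm
    have h2 := congrArg (fun z => (m : ℂ) * z) h1
    simp only [← mul_assoc, Complex.ofReal_inv, mul_inv_cancel₀ hm', one_mul, mul_one] at h2
    exact h2
  have e3 : (1 - ((m⁻¹ : ℝ) : ℂ) * (∑ i, (c i : ℂ) * mFourier k (g i))) •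
      mFourierCoeff (FunctionSpaces.EuclideanSpace.complexify ∘ w t) k = 0 := by
    rw [sub_smul, one_smul, ← e1, sub_self]
  rcases smul_eq_zero.1 e3 with h0 | h0
  · exact absurd (sub_eq_zero.1 h0).symm hne
  · exact h0

/-- **Bloch-sector preservation along a `1/n`-periodic carrier, constant frame.**  `n ≥ 1`, `NearIso 𝔸 lo hi` with `0 < lo`,
non-degenerate constant frame `c₀|k|² ≤ |G₀ᵀk|²` (`0 < c₀`), `b` essentially bounded and invariant under the grid translations
`x ↦ x + (jᵢ/n)ᵢ`, `w₀ ∈ L²` with Fourier support in the symmetric sector `{k : n ∣ kᵢ − ℓᵢ ∀ i} ∪ {k : n ∣ kᵢ + ℓᵢ ∀ i}`.  Then EVERY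
constant-frame distorted weak solution from `w₀` along `b` has, for a.e. `t ∈ (0,T)`, Fourier support in the same sector.
[cite: KhaKuchment2021, §1.1–§1.2 (G-periodic operators, γ_k-automorphic functions, Floquet transform)] [cite: ArmstrongVicol2025, §4.1 (PDF p. 34)] -/
theorem ae_mFourierCoeff_eq_zero_off_sector_constFrame {n : ℕ} (hn : 0 < n) (ℓ : d → ℤ) {lo hi : ℝ} (h𝔸 : NearIso 𝔸 lo hi)
    (hlo : 0 < lo) {c₀ : ℝ} (hc₀ : 0 < c₀) (hG : ∀ k : d → ℤ, c₀ * FunctionSpaces.Torus.freqNormSq k ≤ ∑ a, twistFreq G₀ k a ^ 2)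
    (h : IsWeakTensorPassiveVectorDistortedOn A T 𝔸 b (fun _ _ => G₀) w₀ w)
    (hb : MemLp (FunctionSpaces.Torus.stLift b) ∞ (volume.restrict (Ioo 0 T ×ˢ univ)))
    (hper : ∀ (j : d → Fin n) t x, b t (x + fun i => ((((j i : ℕ) : ℝ) / n : ℝ) : UnitAddCircle)) = b t x)
    (hw₀ : MemLp w₀ 2 volume)
    (hsupp : ∀ k, mFourierCoeff (FunctionSpaces.EuclideanSpace.complexify ∘ w₀) k ≠ 0 →
      (∀ i, (n : ℤ) ∣ k i - ℓ i) ∨ (∀ i, (n : ℤ) ∣ k i + ℓ i)) :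
    ∀ᵐ t ∂(volume.restrict (Ioo 0 T)), ∀ k, ¬ ((∀ i, (n : ℤ) ∣ k i - ℓ i) ∨ (∀ i, (n : ℤ) ∣ k i + ℓ i)) →
      mFourierCoeff (FunctionSpaces.EuclideanSpace.complexify ∘ w t) k = 0 := by
  classical
  haveI : Nonempty (d → Fin n) := ⟨fun _ => ⟨0, hn⟩⟩
  set c : (d → Fin n) → ℝ := fun j => Real.cos (2 * Real.pi * (∑ i, (ℓ i : ℝ) * ((j i : ℕ) : ℝ)) / n) with hc
  set g : (d → Fin n) → UnitAddTorus d := fun j i => ((((j i : ℕ) : ℝ) / n : ℝ) : UnitAddCircle) with hg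
  have hmult : ∀ k : d → ℤ, (∑ j, (c j : ℂ) * mFourier k (g j)) =
      ((if ∀ i, (n : ℤ) ∣ k i + ℓ i then ((n : ℂ) ^ Fintype.card d) else 0) +
        (if ∀ i, (n : ℤ) ∣ k i - ℓ i then ((n : ℂ) ^ Fintype.card d) else 0)) / 2 :=
    fun k => FunctionSpaces.Torus.sum_cos_mul_mFourier_grid hn ℓ k
  set m : ℝ := if ∀ i, (n : ℤ) ∣ 2 * ℓ i then (n : ℝ) ^ Fintype.card d else (n : ℝ) ^ Fintype.card d / 2 with hm_def
  have hnpos : (0 : ℝ) < (n : ℝ) ^ Fintype.card d := by positivity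
  have hm : m ≠ 0 := by
    rw [hm_def]
    split_ifs <;> positivity
  have hval : ∀ k : d → ℤ, ((∀ i, (n : ℤ) ∣ k i - ℓ i) ∨ (∀ i, (n : ℤ) ∣ k i + ℓ i)) →
      (∑ j, (c j : ℂ) * mFourier k (g j)) = m := by
    intro k hk
    rw [hmult k, hm_def]
    have hiff₁ : (∀ i, (n : ℤ) ∣ k i - ℓ i) → ((∀ i, (n : ℤ) ∣ k i + ℓ i) ↔ ∀ i, (n : ℤ) ∣ 2 * ℓ i) := by
      intro h1
      refine ⟨fun h2 i => ?_, fun h2 i => ?_⟩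
      · have := (h2 i).sub (h1 i); rw [show k i + ℓ i - (k i - ℓ i) = 2 * ℓ i by ring] at this; exact this
      · have := (h1 i).add (h2 i); rw [show k i - ℓ i + 2 * ℓ i = k i + ℓ i by ring] at this; exact this
    have hiff₂ : (∀ i, (n : ℤ) ∣ k i + ℓ i) → ((∀ i, (n : ℤ) ∣ k i - ℓ i) ↔ ∀ i, (n : ℤ) ∣ 2 * ℓ i) := by
      intro h1
      refine ⟨fun h2 i => ?_, fun h2 i => ?_⟩
      · have := (h1 i).sub (h2 i); rw [show k i + ℓ i - (k i - ℓ i) = 2 * ℓ i by ring] at this; exact this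
      · have := (h1 i).sub (h2 i); rw [show k i + ℓ i - 2 * ℓ i = k i - ℓ i by ring] at this; exact this
    rcases hk with h1 | h1
    · rw [if_pos h1]
      by_cases h2 : ∀ i, (n : ℤ) ∣ 2 * ℓ i
      · rw [if_pos ((hiff₁ h1).2 h2), if_pos h2]; push_cast; ring
      · rw [if_neg (fun h' => h2 ((hiff₁ h1).1 h')), if_neg h2]; push_cast; ring
    · rw [if_pos h1]
      by_cases h2 : ∀ i, (n : ℤ) ∣ 2 * ℓ i
      · rw [if_pos ((hiff₂ h1).2 h2), if_pos h2]; push_cast; ring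
      · rw [if_neg (fun h' => h2 ((hiff₂ h1).1 h')), if_neg h2]; push_cast; ring
  have hoff : ∀ k : d → ℤ, ¬ ((∀ i, (n : ℤ) ∣ k i - ℓ i) ∨ (∀ i, (n : ℤ) ∣ k i + ℓ i)) →
      (∑ j, (c j : ℂ) * mFourier k (g j)) ≠ m := by
    intro k hk
    rw [hmult k, if_neg (fun h' => hk (Or.inr h')), if_neg (fun h' => hk (Or.inl h')), add_zero, zero_div]
    exact_mod_cast hm.symm
  have hmain := h.ae_mFourierCoeff_eq_zero_of_multiplier_constFrame' h𝔸 hlo hc₀ hG hb g c (fun j t x => hper j t x) hw₀ hm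
    (fun k hk => hval k (hsupp k hk))
  filter_upwards [hmain] with t ht k hk
  exact ht k (hoff k hk)

end IsWeakTensorPassiveVectorDistortedOn

end Torus

end Literature.Analysis.FluidPDE

end
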